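import Literature.MathematicalPhysics.QuantumFieldTheory.QCDHeavyQuarkPropagator
import Literature.MathematicalPhysics.QuantumLattice.TwistedFreeWilsonDirac
import HarnessLib

/-!
# The phase-quenched weight of lattice QCD has positive mass at every bare-mass tuple

Topic `Literature/MathematicalPhysics/QuantumFieldTheory`; namespace
`Literature.MathematicalPhysics.QuantumFieldTheory`.

`QCDPhaseQuenchedReweighting.lean` proves `0 < ∫ |det D(U)| dμ_W(β)` from ONE configuration with
`det D ≠ 0` (`integral_norm_det_diracMatrix_pos_of_exists`) and leaves that witness as a hypothesis
("e.g. the free field `U ≡ 1` for bare masses off the finitely many free doubler values").  The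
constant diagonal `SU(3)` twist of `QuantumLattice/TwistedFreeWilsonDirac.lean` is such a witness for
EVERY real mass simultaneously (`exists_gaugeConfig_wilsonDirac_det_ne_zero`), so the hypothesis is
discharged unconditionally:

* `integral_norm_det_diracMatrix_pos_all` — `0 < ∫ |det (diracMatrix U mq)| dμ_W(β)` for every
  `N_f`, every `mq : Fin N_f → ℝ`, every `β ∈ ℝ`, every torus side `L ≥ 1`;
* `qcdPhaseQuenchedExpect_const_all` — the phase-quenched expectation is normalised, `⟨c⟩₊ = c`;
* `isProbabilityMeasure_qcdLatticeMeasure_all` — `qcdLatticeMeasure` is a probability measure;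
* `qcdPhaseQuenchedExpect_jensen_all` — Jensen's inequality for `⟨·⟩₊` without the positivity
  hypothesis.

Consequence for the routes: every phase-quenched quotient written in the QCD Theses files
(`MobilityGap` (ii)–(iv), `PhaseQuenchedFlavourDecay`, `FMClosureUnquenched`, …) has a positive
denominator at every step `k`, volume `S` and mass tuple — no `x / 0 = 0` junk case remains.
Origin: clause (T0) of the two-star bounds of crux `PauliWegnerSea.FMClosureUnquenched`
(stmt-QuantumFields-11512), lean-checked by a stub worker and restyled for the Literature tree.
-/

noncomputable section

open MeasureTheory
open Literature.MathematicalPhysics.QuantumLattice Literature.Probability.LatticeModels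

namespace Literature.MathematicalPhysics.QuantumFieldTheory

variable {Nf : ℕ} {S : ℕ} [NeZero S]

/-- **The multi-flavour Wilson determinant of the constant twisted field is non-zero for every mass
tuple** (flavour by flavour `wilsonDirac_twistCfg_det_ne_zero`). [folklore] -/
theorem det_diracMatrix_twistCfg_ne_zero (mq : Fin Nf → ℝ) :
    (diracMatrix (TwistedFreeWilson.twistCfg S) mq).det ≠ 0 :=
  det_diracMatrix_ne_zero_of_forall _ _ fun f => wilsonDirac_twistCfg_det_ne_zero (mq f)

/-- **Positivity of the phase-quenched denominator for all parameters**: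
`0 < ∫ |det D(U)| dμ_W(β)` for every `N_f`, every bare-mass tuple, every real `β` and every torus
side `L ≥ 1` (the Wilson measure charges the open set where the continuous `|det D|` is positive,
which contains the constant twisted field). [folklore] -/
theorem integral_norm_det_diracMatrix_pos_all (β : ℝ) (mq : Fin Nf → ℝ) :
    0 < ∫ U, ‖(diracMatrix U mq).det‖
      ∂(wilsonMeasure (d := 4) (L := S) (fundamentalRep (Fin 3)) β) :=
  integral_norm_det_diracMatrix_pos_of_exists β mq
    ⟨TwistedFreeWilson.twistCfg S, det_diracMatrix_twistCfg_ne_zero mq⟩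

/-- The phase-quenched expectation is normalised at every parameter: `⟨c⟩₊ = c`. [folklore] -/
theorem qcdPhaseQuenchedExpect_const_all {E : Type*} [NormedAddCommGroup E] [NormedSpace ℝ E]
    [CompleteSpace E] (β : ℝ) (mq : Fin Nf → ℝ) (c : E) :
    qcdPhaseQuenchedExpect β S mq (fun _ => c) = c :=
  qcdPhaseQuenchedExpect_const β mq (integral_norm_det_diracMatrix_pos_all β mq).ne' c

/-- The phase-quenched lattice QCD measure is a probability measure at every parameter. [folklore] -/
theorem isProbabilityMeasure_qcdLatticeMeasure_all (β : ℝ) (mq : Fin Nf → ℝ) :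
    IsProbabilityMeasure (qcdLatticeMeasure S β mq) :=
  isProbabilityMeasure_qcdLatticeMeasure β mq (integral_norm_det_diracMatrix_pos_all β mq)

/-- **Jensen's inequality for `⟨·⟩₊` at every parameter**: for a convex continuous `g` on a closed
convex `s ⊆ ℝ` and a real observable `φ` with values a.e. in `s`, `g ⟨φ⟩₊ ≤ ⟨g ∘ φ⟩₊`
(`qcdPhaseQuenchedExpect_jensen` with its positivity hypothesis discharged). [folklore] -/
theorem qcdPhaseQuenchedExpect_jensen_all (β : ℝ) (mq : Fin Nf → ℝ)
    {s : Set ℝ} {g : ℝ → ℝ} (hg : ConvexOn ℝ s g) (hgc : ContinuousOn g s) (hs : IsClosed s)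
    (φ : GaugeConfig 4 S SU3 → ℝ) (hφs : ∀ᵐ U ∂(qcdLatticeMeasure S β mq), φ U ∈ s)
    (hφi : Integrable φ (qcdLatticeMeasure S β mq))
    (hgφi : Integrable (g ∘ φ) (qcdLatticeMeasure S β mq)) :
    g (qcdPhaseQuenchedExpect β S mq φ) ≤ qcdPhaseQuenchedExpect β S mq (g ∘ φ) :=
  qcdPhaseQuenchedExpect_jensen β mq (integral_norm_det_diracMatrix_pos_all β mq) hg hgc hs φ hφs
    hφi hgφi

end Literature.MathematicalPhysics.QuantumFieldTheory

end
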